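import Summits.ABC.IUTFork.Repair.RHDiffPriced
import Summits.ABC.IUTFork.Repair.RHHullThresholdExact
import Summits.ABC.IUTFork.Repair.RHTameBandLicence
import Literature.IUT.LogVolume.DifferentOrdDivisor
import HarnessLib

/-!
# R-H ROUND 1 row 16 «diffpriced» — the WILD door: H⋆_𝔡 ⟹ the hull closed form (row 4) at EVERY stratum, by integer arithmetic
# (D-0079 RESCUE sub-cell R-H, lens TRANSFER seat abc-iut-lens-transfer-3 gen 2; DICTIONARY row «Riemann–Hurwitz different ↔ content shift»)

[R-H candidate bookkeeping — hypotheses, not facts.] Author-side file of the abc-iut cell (rung LADDER-ABC:A2.RESCUE.H; plan/rescue/R-H/START-HERE.md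
v1.3 §3 (k2), §8 A2). TAKES NO SIDE on [IUTchIII] Cor. 3.12 or on any author; nothing here asserts abc proved or refuted; `HStarDiffPriced`
(row 16, p458364) and `HStarClosedForm` / `HullCell` (row 4, abc-iut-rh-typ-4, `Repair.RHHullThresholdExact`) are claim-tagged CANDIDATE
HYPOTHESES / a CONJECTURED column formula, never Literature facts; typed ≠ proved; refuted-as-typed ≠ refuted-in-print. This file is SORRY-FREE
BOOKKEEPING between two typed rows plus one definition (the different exponent as a free parameter); a prover hand re-files it (lens seats do not file).

WHAT IS PROVED (namespace `Summit.ABC.IUTFork.Repair.RH.DiffPricedHull`):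
* `HullCellδ e m j δ r_in r_out :⟺ e·⌊(j²m − j·δ − (j+1)·r_in)/e⌋ ≤ m − (j+1)·r_out` — row 4's closed form with the DIFFERENT EXPONENT `δ`
  (`= e_w·d_w`, [IUTchIV] Prop. 1.1) as a parameter: abc-iut-c312-5's exact per-summand criterion «`v_p(t_q) − Σβ ≥ ⌊v_p(t_Θ) − (d_I − min_J d_{L_J}) − Σα⌋`»
  (`TensorPacketLicenceExact`, PROVED at packet level) read at the diagonal summand of `j+1` factors `≅ K_w` with UNIFORM GALOIS fibres
  (`d_I − min_J d_{L_J} = j·d_w`, abc-iut-rp-d1 ROW4-K2-MEMO §4 / lens-negation-1 «assumption G») and realising ideles; `hullCellδ_tame_iff`: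
  at `δ = e − 1` it is LITERALLY abc-iut-rh-typ-4's `HullThresholdExact.HullCell` (`Iff.rfl`) — the typ-4 column is the tame-different instance.
* **`hullCellδ_of_cell`** — THE ARITHMETIC: `0 < e`, `0 ≤ j+1`, `r_out ≤ r_in` (trivial: `𝔪^{r_in} ⊆ Λ_w ⊆ 𝔪^{r_out}`) and the row-16 cell
  `(j² − 1)·m ≤ j·δ` give `HullCellδ e m j δ r_in r_out`, because `e·⌊X/e⌋ ≤ X = j²m − jδ − (j+1)r_in ≤ m − (j+1)r_in ≤ m − (j+1)r_out`.
  So the different defect `D_I = j·d_w` enters the EXACT cell on the SUFFICIENT side through the content shift `m⋆`, and the row-16 cell is a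
  RADII-FREE MINORANT of the closed form at tame, boundary AND deep places alike (retracts the seat's gen-0 «KILL(k2-wild)» prediction, CARD (W)).
* `hullCellδ_mono` — a LARGER different exponent only HELPS the closed form (`δ ≤ δ'`); `hullCellδ_of_hullCell` — typ-4's `(e−1)`-column POS
  ⟹ true-`δ` closed form POS whenever `e − 1 ≤ δ` ([SerreLocalFields1979] III §6 Prop. 13: always, with equality iff `p ∤ e`).
* GENUINE `K`-level datum `X := pilotDataOfK D K` ([IUTchI] Def. 3.1): `absRamificationIdx_mul_differentOrd_kOf` — the CARD's price
  `e_w·d_w` IS `ord_w(𝔇_{K/ℤ})`, the multiplicity of `w` in the absolute different (`differentOrd_rescaledCompletion`, [SerreLocalFields1979] III §4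
  Prop. 10) — the Riemann–Hurwitz / different-divisor entry of the transfer DICTIONARY; **`hStarDiffPriced_iff_int`** — H⋆_𝔡 ⟺ «∀ bad `w ∣ p`, ∀ `j`:
  `(j²−1)·P_w ≤ j·ord_w(𝔇_{K/ℤ})` in `ℤ`» (`P_w ∈ ℕ`, `exists_nat_qPilot_pilotDataOfK`); **`hullCellδ_of_hStarDiffPriced`** — ROW 16 ⟹ the true-`δ`
  closed form at every bad place for ANY radii data with `r_out ≤ r_in`; **`hStarClosedForm_of_hStarDiffPriced`** — if every bad place has `p ∤ e_w`
  (tame different, any depth `p ≶ e_w`), ROW 16 ⟹ ROW 4's `HStarClosedForm (pilotDataOfK D K) r_in r_out` for any such radii: row 16's k2 at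
  wild/deep places is row 4's k2 (ORBIT-SATURATION / U2-LICENCE-WRAPPER), no separate door.
[cite: Mochizuki2012, IUTchI Def. 3.1 (b),(c) pp. 61–62, Ex. 3.2 (iv) p. 71; IUTchIII Step (xi-f) p. 184; IUTchIV Prop. 1.1 p. 9, Prop. 1.2 (i)(ii) p. 10, Prop. 1.4 p. 13]
[cite: SerreLocalFields1979, Ch. III §4 Prop. 10, §6 Prop. 13] [cite: DupuyHilado2025, §3.3, §3.4, §4.9, §4.12] [claim: Mochizuki2012, status: disputed]
for every IUT locution quoted. Axioms: standard.
-/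

noncomputable section

open Set Function NumberField IsDedekindDomain
open scoped Pointwise

namespace Summit.ABC.IUTFork.Repair.RH.DiffPricedHull

open Literature.AnabelianGeometry.AbsoluteAnabelian Literature.IUT.LogThetaLattice Literature.IUT.LogVolume Literature.IUT.HodgeTheaters
open Literature.NumberTheory.NumberFields Literature.NumberTheory.GaloisRepresentations.Ultrametric
open Summit.ABC.IUTFork.Thm311 Summit.ABC.IUTFork.Thm311.Real Summit.ABC.IUTFork.Cor312 Summit.ABC.IUTFork.Cor312.Setting
  Summit.ABC.IUTFork.Cor312Vol Summit.ABC.IUTFork.Cor312Prov Summit.ABC.IUTFork.Repair.RH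

/-! ## §1. The closed form with the different exponent as a parameter (integers, `ϖ_w`-units; `/` = `Int.ediv` = floor for `e > 0`) -/

/-- **`HullCellδ e m j δ r_in r_out`** :⟺ `e·⌊(j²·m − j·δ − (j+1)·r_in)/e⌋ ≤ m − (j+1)·r_out`: row 4's closed form (abc-iut-c312-5's exact
per-summand criterion at the diagonal packet, uniform Galois fibres, realising ideles) with the different exponent `δ = e_w·d_w` of `K_w/ℚ_p`
([IUTchIV] Prop. 1.1) as a free parameter. CONJECTURED column formula of the typed hull, exactly as `HullThresholdExact.HullCell` (which is the
instance `δ = e − 1`). [R-H bookkeeping, not a fact] [cite: Mochizuki2012, IUTchIV Prop. 1.1 p. 9, Prop. 1.4 p. 13] [claim: Mochizuki2012, status: disputed] -/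
@[claim "Mochizuki2012" "disputed"]
def HullCellδ (e m j δ rin rout : ℤ) : Prop :=
  e * ((j ^ 2 * m - j * δ - (j + 1) * rin) / e) ≤ m - (j + 1) * rout

/-- **Calibration**: at the tame different exponent `δ = e − 1` the parametrised closed form IS abc-iut-rh-typ-4's `HullCell` (row 4), literally.
[folklore] -/
theorem hullCellδ_tame_iff (e m j rin rout : ℤ) :
    HullCellδ e m j (e - 1) rin rout ↔ HullThresholdExact.HullCell e m j rin rout :=
  Iff.rfl

/-- **THE ARITHMETIC (row 16 ⟹ closed form, every stratum).** If `0 < e`, `0 ≤ j + 1`, the radii exponents satisfy `r_out ≤ r_in`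
(`𝔪^{r_in} ⊆ Λ_w ⊆ 𝔪^{r_out}`) and the different-priced cell `(j² − 1)·m ≤ j·δ` holds, then `HullCellδ e m j δ r_in r_out`:
`e·⌊X/e⌋ ≤ X = j²m − jδ − (j+1)r_in ≤ m − (j+1)r_in ≤ m − (j+1)r_out`. [folklore] -/
theorem hullCellδ_of_cell {e m j δ rin rout : ℤ} (he : 0 < e) (hj : 0 ≤ j + 1) (hio : rout ≤ rin)
    (h : (j ^ 2 - 1) * m ≤ j * δ) : HullCellδ e m j δ rin rout := by
  unfold HullCellδ
  have h1 := Int.mul_ediv_add_emod (j ^ 2 * m - j * δ - (j + 1) * rin) e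
  have h2 := Int.emod_nonneg (j ^ 2 * m - j * δ - (j + 1) * rin) he.ne'
  have h3 : (j + 1) * rout ≤ (j + 1) * rin := mul_le_mul_of_nonneg_left hio hj
  nlinarith [h1, h2, h3, h]

/-- **A larger different exponent only helps** (`0 < e`, `0 ≤ j`, `δ ≤ δ'`): the content shift `m⋆ = ⌊(j²m − jδ − (j+1)r_in)/e⌋` decreases.
[folklore] -/
theorem hullCellδ_mono {e m j δ δ' rin rout : ℤ} (he : 0 < e) (hj : 0 ≤ j) (h : δ ≤ δ') (hc : HullCellδ e m j δ rin rout) :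
    HullCellδ e m j δ' rin rout := by
  unfold HullCellδ at hc ⊢
  have hle : j ^ 2 * m - j * δ' - (j + 1) * rin ≤ j ^ 2 * m - j * δ - (j + 1) * rin := by
    nlinarith [mul_le_mul_of_nonneg_left h hj]
  have hdiv := Int.ediv_le_ediv he hle
  nlinarith [mul_le_mul_of_nonneg_left hdiv he.le]

/-- **typ-4's `(e−1)`-column is a minorant of the true-`δ` closed form**: `e − 1 ≤ δ` ([SerreLocalFields1979] III §6 Prop. 13) and
`HullCell e m j r_in r_out` give `HullCellδ e m j δ r_in r_out` — wild POS cells of the `(e−1)`-column stay POS at the true different.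
[cite: SerreLocalFields1979, Ch. III §6 Prop. 13] -/
theorem hullCellδ_of_hullCell {e m j δ rin rout : ℤ} (he : 0 < e) (hj : 0 ≤ j) (hδ : e - 1 ≤ δ)
    (hc : HullThresholdExact.HullCell e m j rin rout) : HullCellδ e m j δ rin rout :=
  hullCellδ_mono he hj hδ ((hullCellδ_tame_iff e m j rin rout).mpr hc)

/-- Sanity rows (k1 witnesses, `w`-units). HEX:4:7@p7.j3.ev1 (`e = 7`, `m = 4`, wild, Hilbert lower door `δ ≥ e − 1 + (p − 1) = 12`): the
row-16 cell `8·4 = 32 ≤ 3·12 = 36` holds and so does the closed form at ANY radii with `r_out ≤ r_in`, e.g. the certified pair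
`(r_in, r_out) = (2, -2)`; at the tame exponent `δ = 6` the row-16 cell fails (`32 > 18`). lamSeven:k=2:l=13 type ev=1 (`e = 13`, `m = 2`, `j = 6`,
tame): `35·2 = 70 ≤ 6·12 = 72`. [folklore] -/
theorem rows_sanity :
    ((3 : ℤ) ^ 2 - 1) * 4 ≤ 3 * 12 ∧ HullCellδ 7 4 3 12 2 (-2) ∧ ¬ ((3 : ℤ) ^ 2 - 1) * 4 ≤ 3 * 6 ∧
      ((6 : ℤ) ^ 2 - 1) * 2 ≤ 6 * 12 ∧ HullCellδ 13 2 6 12 1 1 := by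
  unfold HullCellδ; decide

/-! ## §2. At the GENUINE `K`-level datum `X := pilotDataOfK D K`: the price is `ord_w(𝔇_{K/ℤ})`, and ROW 16 ⟹ ROW 4's closed form -/

section Genuine

variable {F K Fbar : Type} [Field F] [NumberField F] [Field K] [NumberField K] [Algebra F K] [Field Fbar]
  [Algebra F Fbar] [Algebra K Fbar] {E : WeierstrassCurve F} [E.IsElliptic] {l : ℕ} {Pb : BadPlacePredicates K}
  (D : InitialThetaData F K Fbar E l Pb)

-- `ramificationIdx_placeOf_pos` is abc-iut-rh-typ-5's `RH.TameBandLicence.ramificationIdx_placeOf_pos` (Repair/RHTameBandLicence.lean), reused BY NAME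
-- (proxy-filer's dedup fix, rp-d3 g5: the staged bytes re-proved it verbatim; gate `dedup.landed`).

/-- **DICTIONARY ENTRY `e_w·d_w = ord_w(𝔇_{K/ℤ})`.** At a place `w ∣ p` of the genuine datum the CARD's price `e_w·d_w`
(`absRamificationIdx · differentOrd` of the rescaled completion `K_w`) is the multiplicity of `w` in the absolute different of `K` — the
local term of the Riemann–Hurwitz / different divisor `𝔡_K = Σ_w ord_w(𝔇)·w`. [cite: SerreLocalFields1979, Ch. III §4 Prop. 10]
[cite: MochizukiGenEll2010, Def. 1.5 (iii) p. 9] -/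
theorem absRamificationIdx_mul_differentOrd_kOf (pp : Nat.Primes) (w : (thetaIndex (pilotDataOfK D K)).Fibre (.inr pp)) :
    haveI : Fact (pp : ℕ).Prime := ⟨pp.2⟩
    (absRamificationIdx (pp : ℕ) (kOf (pilotDataOfK D K) pp.1 w) : ℝ) * differentOrd (pp : ℕ) (kOf (pilotDataOfK D K) pp.1 w) =
      (multiplicity (placeOf (pilotDataOfK D K) pp.1 w).asIdeal (differentIdeal ℤ (𝓞 K)) : ℝ) := by
  haveI : Fact (pp : ℕ).Prime := ⟨pp.2⟩
  have he : absRamificationIdx (pp : ℕ) (kOf (pilotDataOfK D K) pp.1 w) =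
      (placeOf (pilotDataOfK D K) pp.1 w).asIdeal.ramificationIdx ℤ :=
    absRamificationIdx_rescaledCompletion K (pp : ℕ) (placeOf (pilotDataOfK D K) pp.1 w)
      (natCast_mem_placeOf (pilotDataOfK D K) pp.1 w)
  have hd : differentOrd (pp : ℕ) (kOf (pilotDataOfK D K) pp.1 w) =
      (multiplicity (placeOf (pilotDataOfK D K) pp.1 w).asIdeal (differentIdeal ℤ (𝓞 K)) : ℝ) /
        ((placeOf (pilotDataOfK D K) pp.1 w).asIdeal.ramificationIdx ℤ : ℝ) :=
    differentOrd_rescaledCompletion K (pp : ℕ) (placeOf (pilotDataOfK D K) pp.1 w)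
      (natCast_mem_placeOf (pilotDataOfK D K) pp.1 w)
  have he0 : ((placeOf (pilotDataOfK D K) pp.1 w).asIdeal.ramificationIdx ℤ : ℝ) ≠ 0 := by
    exact_mod_cast (TameBandLicence.ramificationIdx_placeOf_pos D pp w).ne'
  rw [he, hd, mul_div_cancel₀ _ he0]

/-- **H⋆_𝔡 in integers at the genuine datum.** ROW 16 ⟺ «at every bad place `w ∣ p` with (integral) pilot degree `P_w = P` and every
label `j = i+1`: `(j² − 1)·P ≤ j·ord_w(𝔇_{K/ℤ})`». [R-H candidate, hypothesis — not a fact]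
[cite: Mochizuki2012, IUTchI Ex. 3.2 (iv) p. 71; IUTchIV Prop. 1.1 p. 9] [claim: Mochizuki2012, status: disputed] -/
theorem hStarDiffPriced_iff_int :
    DiffPriced.HStarDiffPriced D ↔
      ∀ (pp : Nat.Primes) (i : Fin (pilotDataOfK D K).lstar) (w : (thetaIndex (pilotDataOfK D K)).Fibre (.inr pp)),
        haveI : Fact (pp : ℕ).Prime := ⟨pp.2⟩
        placeOf (pilotDataOfK D K) pp.1 w ∈ (pilotDataOfK D K).S →
          ∀ P : ℕ, (pilotDataOfK D K).qPilot (placeOf (pilotDataOfK D K) pp.1 w) = P →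
            ((((i : ℕ) + 1 : ℕ) : ℤ) ^ 2 - 1) * (P : ℤ) ≤
              (((i : ℕ) + 1 : ℕ) : ℤ) * (multiplicity (placeOf (pilotDataOfK D K) pp.1 w).asIdeal (differentIdeal ℤ (𝓞 K)) : ℤ) := by
  constructor
  · intro hH pp i w hw P hP
    haveI : Fact (pp : ℕ).Prime := ⟨pp.2⟩
    have hcell := hH pp i w hw
    have hed := absRamificationIdx_mul_differentOrd_kOf D pp w
    simp only [DiffPriced.Cell, hP, hed] at hcell
    have h' : ((((((i : ℕ) + 1 : ℕ) : ℤ) ^ 2 - 1) * (P : ℤ) : ℤ) : ℝ) ≤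
        (((((i : ℕ) + 1 : ℕ) : ℤ) *
          (multiplicity (placeOf (pilotDataOfK D K) pp.1 w).asIdeal (differentIdeal ℤ (𝓞 K)) : ℤ) : ℤ) : ℝ) := by
      push_cast at hcell ⊢
      linarith
    exact_mod_cast h'
  · intro h pp i w hw
    haveI : Fact (pp : ℕ).Prime := ⟨pp.2⟩
    obtain ⟨P, hP, -, -⟩ := exists_nat_qPilot_pilotDataOfK D hw
    have hint := h pp i w hw P hP
    have hed := absRamificationIdx_mul_differentOrd_kOf D pp w
    show DiffPriced.Cell _ _ _ _
    simp only [DiffPriced.Cell, hP, hed]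
    have h' : ((((((i : ℕ) + 1 : ℕ) : ℤ) ^ 2 - 1) * (P : ℤ) : ℤ) : ℝ) ≤
        (((((i : ℕ) + 1 : ℕ) : ℤ) *
          (multiplicity (placeOf (pilotDataOfK D K) pp.1 w).asIdeal (differentIdeal ℤ (𝓞 K)) : ℤ) : ℤ) : ℝ) := by
      exact_mod_cast hint
    push_cast at h' ⊢
    linarith

/-- **ROW 16 ⟹ the true-`δ` closed form at EVERY bad place** (tame, boundary or deep), for ANY radii data with `r_out ≤ r_in` at the bad
places (`𝔪^{r_in} ⊆ Λ_w ⊆ 𝔪^{r_out}`): `HullCellδ e_w P (i+1) ord_w(𝔇) (r_in w) (r_out w)`. The different defect is SUFFICIENT-side capacity.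
[R-H bookkeeping] [cite: Mochizuki2012, IUTchIV Prop. 1.2 (i)(ii) p. 10, Prop. 1.4 p. 13] [claim: Mochizuki2012, status: disputed] -/
theorem hullCellδ_of_hStarDiffPriced (hH : DiffPriced.HStarDiffPriced D)
    (rin rout : ∀ pp : Nat.Primes, (thetaIndex (pilotDataOfK D K)).Fibre (.inr pp) → ℤ)
    (hio : ∀ (pp : Nat.Primes) (w : (thetaIndex (pilotDataOfK D K)).Fibre (.inr pp)),
      haveI : Fact (pp : ℕ).Prime := ⟨pp.2⟩
      placeOf (pilotDataOfK D K) pp.1 w ∈ (pilotDataOfK D K).S → rout pp w ≤ rin pp w)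
    (pp : Nat.Primes) (i : Fin (pilotDataOfK D K).lstar) (w : (thetaIndex (pilotDataOfK D K)).Fibre (.inr pp))
    (hw : haveI : Fact (pp : ℕ).Prime := ⟨pp.2⟩; placeOf (pilotDataOfK D K) pp.1 w ∈ (pilotDataOfK D K).S) (P : ℕ)
    (hP : haveI : Fact (pp : ℕ).Prime := ⟨pp.2⟩; (pilotDataOfK D K).qPilot (placeOf (pilotDataOfK D K) pp.1 w) = P) :
    haveI : Fact (pp : ℕ).Prime := ⟨pp.2⟩
    HullCellδ ((placeOf (pilotDataOfK D K) pp.1 w).asIdeal.ramificationIdx ℤ : ℤ) (P : ℤ) ((i : ℕ) + 1 : ℤ)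
      (multiplicity (placeOf (pilotDataOfK D K) pp.1 w).asIdeal (differentIdeal ℤ (𝓞 K)) : ℤ) (rin pp w) (rout pp w) := by
  haveI : Fact (pp : ℕ).Prime := ⟨pp.2⟩
  have hint := (hStarDiffPriced_iff_int D).mp hH pp i w hw P hP
  have he0 : (0 : ℤ) < ((placeOf (pilotDataOfK D K) pp.1 w).asIdeal.ramificationIdx ℤ : ℤ) := by
    exact_mod_cast TameBandLicence.ramificationIdx_placeOf_pos D pp w
  have hj : (0 : ℤ) ≤ ((i : ℕ) + 1 : ℤ) + 1 := by positivity
  have hcast : (((i : ℕ) + 1 : ℕ) : ℤ) = ((i : ℕ) + 1 : ℤ) := by push_cast; ring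
  rw [hcast] at hint
  exact hullCellδ_of_cell he0 hj (hio pp w hw) hint

/-- **ROW 16 ⟹ ROW 4 (closed form) when every bad place has tame different** (`p ∤ e_w`, any depth — `p < e_w` allowed): for ANY radii
data with `r_out ≤ r_in` at the bad places, `HStarDiffPriced D → HStarClosedForm (pilotDataOfK D K) r_in r_out`. Hence on such data row 16's
k2 is row 4's k2 (the conjectured identification of the closed form with the typed hull cell: ORBIT-SATURATION / U2-LICENCE-WRAPPER), and every
row-16-POS cell is a row-4-POS cell at the true radii. [R-H bookkeeping] [cite: SerreLocalFields1979, Ch. III §6 Prop. 13]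
[cite: Mochizuki2012, IUTchIV Prop. 1.2 (i)(ii) p. 10] [claim: Mochizuki2012, status: disputed] -/
theorem hStarClosedForm_of_hStarDiffPriced (hH : DiffPriced.HStarDiffPriced D)
    (rin rout : ∀ pp : Nat.Primes, (thetaIndex (pilotDataOfK D K)).Fibre (.inr pp) → ℤ)
    (hio : ∀ (pp : Nat.Primes) (w : (thetaIndex (pilotDataOfK D K)).Fibre (.inr pp)),
      haveI : Fact (pp : ℕ).Prime := ⟨pp.2⟩
      placeOf (pilotDataOfK D K) pp.1 w ∈ (pilotDataOfK D K).S → rout pp w ≤ rin pp w)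
    (hnd : ∀ (pp : Nat.Primes) (w : (thetaIndex (pilotDataOfK D K)).Fibre (.inr pp)),
      haveI : Fact (pp : ℕ).Prime := ⟨pp.2⟩
      placeOf (pilotDataOfK D K) pp.1 w ∈ (pilotDataOfK D K).S →
        ¬ (pp : ℕ) ∣ (placeOf (pilotDataOfK D K) pp.1 w).asIdeal.ramificationIdx ℤ) :
    HullThresholdExact.HStarClosedForm (pilotDataOfK D K) rin rout := by
  intro pp i w hw P hP
  haveI : Fact (pp : ℕ).Prime := ⟨pp.2⟩
  have hδ := hullCellδ_of_hStarDiffPriced D hH rin rout hio pp i w hw P hP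
  -- at `p ∤ e_w` the different exponent is `e_w − 1`
  have he : absRamificationIdx (pp : ℕ) (kOf (pilotDataOfK D K) pp.1 w) =
      (placeOf (pilotDataOfK D K) pp.1 w).asIdeal.ramificationIdx ℤ :=
    absRamificationIdx_rescaledCompletion K (pp : ℕ) (placeOf (pilotDataOfK D K) pp.1 w)
      (natCast_mem_placeOf (pilotDataOfK D K) pp.1 w)
  have hnd' : ¬ (pp : ℕ) ∣ absRamificationIdx (pp : ℕ) (kOf (pilotDataOfK D K) pp.1 w) := by
    rw [he]; exact hnd pp w hw
  have htame := differentOrd_eq_of_not_dvd (pp : ℕ) (kOf (pilotDataOfK D K) pp.1 w) hnd'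
  have hed := absRamificationIdx_mul_differentOrd_kOf D pp w
  have he0 : ((placeOf (pilotDataOfK D K) pp.1 w).asIdeal.ramificationIdx ℤ : ℝ) ≠ 0 := by
    exact_mod_cast (TameBandLicence.ramificationIdx_placeOf_pos D pp w).ne'
  rw [htame, he, mul_div_cancel₀ _ he0] at hed
  -- `hed : (e_w : ℝ) - 1 = (multiplicity … : ℝ)`; transport to `ℤ`
  have hedZ : ((placeOf (pilotDataOfK D K) pp.1 w).asIdeal.ramificationIdx ℤ : ℤ) - 1 =
      (multiplicity (placeOf (pilotDataOfK D K) pp.1 w).asIdeal (differentIdeal ℤ (𝓞 K)) : ℤ) := by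
    have h' : ((((placeOf (pilotDataOfK D K) pp.1 w).asIdeal.ramificationIdx ℤ : ℤ) - 1 : ℤ) : ℝ) =
        (((multiplicity (placeOf (pilotDataOfK D K) pp.1 w).asIdeal (differentIdeal ℤ (𝓞 K)) : ℤ) : ℤ) : ℝ) := by
      push_cast; exact hed
    exact_mod_cast h'
  rw [← hedZ] at hδ
  exact (hullCellδ_tame_iff _ _ _ _ _).mp hδ

end Genuine

end Summit.ABC.IUTFork.Repair.RH.DiffPricedHull

end
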